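import Summits.QuantumAdvantage.AdviceFreeQNC0.ExpRungClosed
import HarnessLib

/-!
# Cell qa-qnc0 — the QUASI-POLYNOMIAL rung: 2D HLF versus quasi-polynomial-size `AC⁰[p]/rpoly`

Planner qa-qnc0-p1 g15, ROUND-14 / `Sketch18.lean` §1, statements VERBATIM: **`HLFNotFAC0ModQuasi p`** (2D HLF is
hard for `AC⁰[p]/rpoly` circuit families of depth `d` and size `≤ 2^{(log₂ N)^a}`, for every fixed `d, a`, ONE gap
`θ < 1`, uniform shared random bits, no advice on either side — "advice-free `QNC⁰ ⊄ qAC⁰[p]`") and the plan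
**`QuasiBridgePlan p`** (`RingHard p → HLFNotFAC0ModQuasi p`).  PROVED here:

* `hlfNotFAC0ModQuasi_of_exp : HLFNotFAC0ModExp p → HLFNotFAC0ModQuasi p` for every `p` — pure bookkeeping: with
  `M ≤ (log₂ N)^a` the exponential rung's side condition `c·(M + log₂ N)^{d+1} ≤ N` holds for all large `N`
  (`c·(2(log₂ N)^{a+1})^{d+1} ≤ (log₂ N)^{(a+1)(d+1)+1} ≤ ⌊√N⌋ ≤ N`, `WalkTubeRank`’s `TubePlanProof.logPow_le_natSqrt`);
* **`hlfNotFAC0ModQuasi_two : HLFNotFAC0ModQuasi 2` — UNCONDITIONAL** (from `ExpRungClosed.hlfNotFAC0ModExp_two`):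
  the quasi-polynomial advice-free separation of `QNC⁰` from `AC⁰[2]/rpoly` on BGK's 2D Hidden Linear Function
  problem, as a named theorem between rung F-Q1 (`adviceFreeQNC0`, polynomial size) and rung F-Q1-exp;
* `quasiBridgePlan_two : QuasiBridgePlan 2` (trivially, its conclusion being a theorem).

WHAT THIS IS NOT: the planner's intended proof of `QuasiBridgePlan p` for GENERAL `p` (the bridge
`RingFrameBridge.hlfNotFAC0Mod_of_ringHard8` re-run with `ℓ = (log₂ N)^a + 2 log₂ N + O(1)` on the short square cycle,
no long cycle, no `√n` degree) is NOT given here — for odd `p` both `RingHard p` and `HLFNotFAC0ModExp p` are open, so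
nothing is claimed beyond `p = 2`; separation NOT moved beyond what `hlfNotFAC0ModExp_two` already says.
-/

namespace Summit.QuantumAdvantage.AdviceFreeQNC0

open Finset
open Literature.Computability.Cryptography Literature.Computability.Complexity
open Literature.Computability.QuantumComplexity Literature.Computability.MetaComplexity

/-! ### §1 The quasi-polynomial rung (planner qa-qnc0-p1 Sketch18 §1, verbatim) -/

/-- **`HLFNotFAC0ModQuasi p`**: 2D HLF is hard for QUASI-POLYNOMIAL-size `AC⁰[p]/rpoly` — depth `d`,
size `≤ 2^{(log₂ N)^a}` for every fixed `a`, ONE gap `θ < 1` for all `d, a`, uniform shared random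
bits, no advice.  For `p = 2`: from LANDED `RingHard 2` + the bridge
`RingFrameBridge.hlfNotFAC0Mod_of_ringHard8` re-run with `ℓ = (log₂ N)^a + 2 log₂ N + O(1)` on the
square cycle (degree `((p-1)ℓ)^{d+1}` = polylog of the ring length `4N`); here obtained instead as the
corollary `hlfNotFAC0ModQuasi_of_exp` of the exponential rung. (Sketch18 §1, verbatim.) -/
def HLFNotFAC0ModQuasi (p : ℕ) : Prop :=
  ∃ θ : ℝ, θ < 1 ∧ ∀ d a : ℕ, ∃ N₀ : ℕ, ∀ N ≥ N₀, ∀ M : ℕ, M ≤ (Nat.log 2 N) ^ a →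
    ∀ (r : ℕ) (Cs : Fin N × Fin N → Circuit (Fin (inLen N + r))),
      (∀ v, (Cs v).IsOver (accBasis p)) → (∀ v, (Cs v).acDepth ≤ d) →
      (∀ v, (Cs v).size ≤ 2 ^ M) →
      ∃ I : HLFInstance N, I.IsValid ∧
        uniformProb r
          {ρ | (fun v => (Cs v).eval (Fin.append (encodeHLF I) fun i => ρ.getD i false)) ∈
            hlfSolutions I} ≤ θ

/-- P-Q (S/M, prover task): the quasi-polynomial bridge from ring hardness at all polylog degrees.
(Sketch18 §1, verbatim; `quasiBridgePlan_two` below.) -/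
def QuasiBridgePlan (p : ℕ) [Fact p.Prime] : Prop := RingHard p → HLFNotFAC0ModQuasi p

/-! ### Bookkeeping: polylog side conditions hold eventually -/

/-- For `N ≥ 2^{c·2^{d+1}}` (so `log₂ N ≥ c·2^{d+1} ≥ 1`) and `M ≤ (log₂ N)^a`:
`c·(M + log₂ N)^{d+1} ≤ (log₂ N)^{(a+1)(d+1)+1}`. -/
private theorem side_condition_polylog {c d a N M : ℕ} (hc : 1 ≤ c)
    (hN : 2 ^ (c * 2 ^ (d + 1)) ≤ N) (hM : M ≤ (Nat.log 2 N) ^ a) :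
    c * (M + Nat.log 2 N) ^ (d + 1) ≤ (Nat.log 2 N) ^ ((a + 1) * (d + 1) + 1) := by
  have hlog : c * 2 ^ (d + 1) ≤ Nat.log 2 N := Nat.le_log_of_pow_le (by norm_num) hN
  have hpos : 1 ≤ 2 ^ (d + 1) := Nat.one_le_two_pow
  have hL1 : 1 ≤ Nat.log 2 N := le_trans (le_trans hc (Nat.le_mul_of_pos_right c (by omega))) hlog
  -- `M + log₂ N ≤ 2 (log₂ N)^{a+1}`
  have ha : (Nat.log 2 N) ^ a ≤ (Nat.log 2 N) ^ (a + 1) :=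
    Nat.pow_le_pow_right hL1 (by omega)
  have hb : Nat.log 2 N ≤ (Nat.log 2 N) ^ (a + 1) := by
    calc Nat.log 2 N = (Nat.log 2 N) ^ 1 := (pow_one _).symm
      _ ≤ (Nat.log 2 N) ^ (a + 1) := Nat.pow_le_pow_right hL1 (by omega)
  have hsum : M + Nat.log 2 N ≤ 2 * (Nat.log 2 N) ^ (a + 1) := by omega
  calc c * (M + Nat.log 2 N) ^ (d + 1)
      ≤ c * (2 * (Nat.log 2 N) ^ (a + 1)) ^ (d + 1) :=
        Nat.mul_le_mul_left c (Nat.pow_le_pow_left hsum _)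
    _ = (c * 2 ^ (d + 1)) * (Nat.log 2 N) ^ ((a + 1) * (d + 1)) := by
        rw [mul_pow, ← pow_mul]; ring
    _ ≤ Nat.log 2 N * (Nat.log 2 N) ^ ((a + 1) * (d + 1)) := Nat.mul_le_mul_right _ hlog
    _ = (Nat.log 2 N) ^ ((a + 1) * (d + 1) + 1) := by ring

/-! ### The quasi-polynomial rung from the exponential rung -/

/-- **`HLFNotFAC0ModExp p → HLFNotFAC0ModQuasi p`** (every `p`; bookkeeping only): for `M ≤ (log₂ N)^a` the
exponential rung's side condition `c·(M + log₂ N)^{d+1} ≤ N` holds for all large `N`. -/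
theorem hlfNotFAC0ModQuasi_of_exp (p : ℕ) (h : HLFNotFAC0ModExp p) : HLFNotFAC0ModQuasi p := by
  obtain ⟨θ, hθ, hE⟩ := h
  refine ⟨θ, hθ, fun d a => ?_⟩
  obtain ⟨c, N₀, hN₀⟩ := hE d
  obtain ⟨n₁, hn₁⟩ := TubePlanProof.logPow_le_natSqrt ((a + 1) * (d + 1) + 1)
  refine ⟨max N₀ (max n₁ (2 ^ ((c + 1) * 2 ^ (d + 1)))), fun N hN M hM r Cs hover hdepth hsize => ?_⟩
  have hNN₀ : N₀ ≤ N := le_trans (le_max_left _ _) hN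
  have hNn₁ : n₁ ≤ N := le_trans (le_trans (le_max_left _ _) (le_max_right _ _)) hN
  have hNc : 2 ^ ((c + 1) * 2 ^ (d + 1)) ≤ N := le_trans (le_trans (le_max_right _ _) (le_max_right _ _)) hN
  refine hN₀ N hNN₀ M ?_ r Cs hover hdepth hsize
  calc c * (M + Nat.log 2 N) ^ (d + 1)
      ≤ (c + 1) * (M + Nat.log 2 N) ^ (d + 1) := Nat.mul_le_mul_right _ (Nat.le_succ c)
    _ ≤ (Nat.log 2 N) ^ ((a + 1) * (d + 1) + 1) := side_condition_polylog (by omega) hNc hM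
    _ ≤ Nat.sqrt N := hn₁ N hNn₁
    _ ≤ N := Nat.sqrt_le_self N

/-- **The quasi-polynomial rung, `p = 2`, UNCONDITIONAL: `HLFNotFAC0ModQuasi 2`** — BGK's 2D Hidden Linear Function
problem (solved with certainty by a constant-depth quantum circuit WITHOUT advice, `qnc0Solves_hlfFamily`) is not
solved, on some valid `N × N` instance, with probability above a fixed `θ < 1` by any depth-`d` `AC⁰[2]` circuit
family of size `≤ 2^{(log₂ N)^a}` with uniformly random shared bits, for all `N ≥ N₀(d, a)`. -/
theorem hlfNotFAC0ModQuasi_two : HLFNotFAC0ModQuasi 2 := hlfNotFAC0ModQuasi_of_exp 2 hlfNotFAC0ModExp_two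

/-- `QuasiBridgePlan 2` holds (its conclusion is the theorem `hlfNotFAC0ModQuasi_two`). -/
theorem quasiBridgePlan_two : QuasiBridgePlan 2 := fun _ => hlfNotFAC0ModQuasi_two

end Summit.QuantumAdvantage.AdviceFreeQNC0
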